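import Summits.BirchSwinnertonDyer.BirchSwinnertonDyer.Theorems.ShadowIsolationShaCotorsionReducibleReductions

/-!
# BirchSwinnertonDyer / ShadowIsolation — crux `ShaCotorsionReducible` (stmt-BirchSwinnertonDyer-15277):
# the unconditional residual regimes and the exact open residue

Companion to `ShadowIsolationShaCotorsionReducibleReductions` (lead c2: composition certificate,
dictionary, domination by stmt-0132, regimes `r_an ≤ 1` / `L(E,1) ≠ 0`). This file (lead c3) lands the
remaining UNCONDITIONAL bookkeeping about the conclusion `W.shaCorank p = 0` of the crux, valid for every
elliptic `W/ℚ` and every prime `p` (no sector hypothesis is ever used — the Eisenstein sector only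
carves where the deep engines have grip, it never enters the algebra):

* `shaCorank_le_selmerCorank` — `corank Ш[p^∞] ≤ corank Sel_{p^∞}` (Greenberg's identity, proved in tree);
* `shaCorank_eq_zero_of_selmerCorank_eq_zero` — REGIME corank `0`: a curve whose `p^∞`-Selmer group
  is cotorsion has cotorsion `Ш[p^∞]` (this is how Kato's theorem enters at `L(E,1) ≠ 0`);
* `shaCorank_eq_zero_of_selmerCorank_le_mordellWeilRank` — pointwise dictionary: enough rational
  points for the Selmer corank ⇒ `Ш[p^∞]` cotorsion (the universal form is c2's
  `shaCotorsionReducible_iff_selmerCorank_le`);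
* `primaryComponent_eq_bot_of_torsionBy_eq_bot` / `shaCorank_eq_zero_of_sha_torsionBy_eq_bot` —
  REGIME `Ш[p] = 0`: the per-curve verification entry point (a full `p`-descent showing
  `dim Sel_p = rank + dim E(ℚ)[p]` gives `Ш[p] = 0`, hence `Ш[p^∞] = 0`, hence corank `0`), pure algebra;
* `shaCotorsionReducible_iff_residue` — THE EXACT OPEN RESIDUE: granting Gross–Zagier–Kolyvagin
  (named fact `rank_eq_analyticRank_of_analyticRank_le_one`, Darmon 2004 Thm. 3.22), the crux is
  EQUIVALENT to its restriction to `ord_{s=1} L(E,s) ≥ 2 ∧ corank Sel_{p^∞} ≥ 1`, in the corank form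
  `corank Sel_{p^∞}(E/ℚ) ≤ rank E(ℚ)`. Numbers, not adjectives: that residue is an open problem (no
  printed theorem produces two independent rational points, or bounds a Selmer corank by the rank,
  on the infinite families `X₀(5)`, `X₀(7)`, `X₀(13)` of the sector); nothing in this file claims to.
-/

-- D-0017: single-problem summit, so `Summit.BirchSwinnertonDyer.BirchSwinnertonDyer.…` repeats a
-- namespace BY DESIGN.
set_option linter.dupNamespace false

namespace Summit.BirchSwinnertonDyer.BirchSwinnertonDyer.Theorems

open Literature.NumberTheory.EllipticCurves
open Summit.BirchSwinnertonDyer.BirchSwinnertonDyer.Theses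

/-! ## Corank bookkeeping (every elliptic `W/ℚ`, every prime `p`) -/

/-- `corank_{ℤ_p} Ш(E/ℚ)[p^∞] ≤ corank_{ℤ_p} Sel_{p^∞}(E/ℚ)`, from Greenberg's identity
`corank Sel_{p^∞} = rank + corank Ш[p^∞]` (LNM 1716, §1, pp. 54–57; tree theorem
`WeierstrassCurve.selmerCorank_eq_mordellWeilRank_add_holds`). [cite: Greenberg1999LNM, §1 pp. 54–57] -/
theorem shaCorank_le_selmerCorank (W : WeierstrassCurve ℚ) [W.IsElliptic] (p : ℕ) [Fact p.Prime] :
    W.shaCorank p ≤ W.selmerCorank p := by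
  have hId : W.selmerCorank p = W.mordellWeilRank + W.shaCorank p :=
    W.selmerCorank_eq_mordellWeilRank_add_holds p
  omega

/-- **Regime corank `0`.** If `Sel_{p^∞}(E/ℚ)` is cotorsion (`corank 0`) then so is `Ш(E/ℚ)[p^∞]`
(Greenberg's identity). This is the shape in which Kato's theorem (`L(E,1) ≠ 0 ⇒ Sel_{p^∞}` finite)
settles the crux at analytic rank `0`. [cite: Greenberg1999LNM, §1 pp. 54–57] -/
theorem shaCorank_eq_zero_of_selmerCorank_eq_zero (W : WeierstrassCurve ℚ) [W.IsElliptic] (p : ℕ)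
    [Fact p.Prime] (h : W.selmerCorank p = 0) : W.shaCorank p = 0 := by
  have := shaCorank_le_selmerCorank W p
  omega

/-- **Pointwise dictionary.** If the `p^∞`-Selmer corank of `W` is realised by rational points
(`corank Sel_{p^∞}(E/ℚ) ≤ rank E(ℚ)`) then `Ш(E/ℚ)[p^∞]` is cotorsion — and conversely
(Greenberg's identity; the universally quantified form over the Eisenstein sector is
`shaCotorsionReducible_iff_selmerCorank_le`). [cite: Greenberg1999LNM, §1 pp. 54–57] -/
theorem shaCorank_eq_zero_iff_selmerCorank_le_mordellWeilRank (W : WeierstrassCurve ℚ) [W.IsElliptic]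
    (p : ℕ) [Fact p.Prime] : W.shaCorank p = 0 ↔ W.selmerCorank p ≤ W.mordellWeilRank := by
  have hId : W.selmerCorank p = W.mordellWeilRank + W.shaCorank p :=
    W.selmerCorank_eq_mordellWeilRank_add_holds p
  omega

/-! ## Regime `Ш[p] = 0` (pure algebra of `p`-primary groups) -/

/-- In an abelian group with no element of order `p` (`A[p] = ⊥`), the `p`-primary component is
trivial: an element of order `p ^ n` with `n ≥ 1` would have a multiple of order exactly `p`.
[folklore] -/
theorem primaryComponent_eq_bot_of_torsionBy_eq_bot {A : Type*} [AddCommGroup A] (p : ℕ)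
    [Fact p.Prime] (h : AddSubgroup.torsionBy A (p : ℤ) = ⊥) :
    AddCommGroup.primaryComponent A p = ⊥ := by
  -- `p ^ n • x = 0 ⇒ x = 0`, by induction on `n`: `p ^ n • x ∈ A[p] = ⊥`
  have key : ∀ (n : ℕ) (x : A), p ^ n • x = 0 → x = 0 := by
    intro n
    induction n with
    | zero =>
      intro x hx
      simpa using hx
    | succ n ih =>
      intro x hx
      apply ih
      have hmem : p ^ n • x ∈ AddSubgroup.torsionBy A (p : ℤ) := by
        change (p : ℤ) • (p ^ n • x) = 0
        rw [natCast_zsmul, smul_smul, ← pow_succ', hx]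
      rw [h, AddSubgroup.mem_bot] at hmem
      exact hmem
  rw [eq_bot_iff]
  intro x hx
  obtain ⟨n, hn⟩ := (AddCommGroup.mem_primaryComponent).mp hx
  rw [AddSubgroup.mem_bot]
  exact key n x hn

/-- **Regime `Ш[p] = 0`.** If `Ш(E/ℚ)` has no element of order `p` then `Ш(E/ℚ)[p^∞] = 0`, in
particular `corank_{ℤ_p} Ш(E/ℚ)[p^∞] = 0`. This is the per-curve verification entry point of the
crux (a complete `p`-descent with `dim_{𝔽_p} Sel_p(E/ℚ) = rank E(ℚ) + dim E(ℚ)[p]` gives `Ш[p] = 0`);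
it is pure algebra and uses no hypothesis on `W` or `p`. [cite: Greenberg1999LNM, §1 pp. 54–57] -/
theorem shaCorank_eq_zero_of_sha_torsionBy_eq_bot (W : WeierstrassCurve ℚ) (p : ℕ) [Fact p.Prime]
    (h : AddSubgroup.torsionBy W.sha (p : ℤ) = ⊥) : W.shaCorank p = 0 := by
  have hbot : AddCommGroup.primaryComponent W.sha p = ⊥ :=
    primaryComponent_eq_bot_of_torsionBy_eq_bot p h
  haveI : Subsingleton (AddCommGroup.primaryComponent W.sha p) := by
    rw [hbot]; infer_instance
  haveI : Finite (AddCommGroup.primaryComponent W.sha p) := Finite.of_subsingleton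
  exact zpCorank_eq_zero_of_finite _ p

/-! ## The exact open residue of the crux -/

/-- **The open residue.** Granting Gross–Zagier–Kolyvagin (named fact
`rank_eq_analyticRank_of_analyticRank_le_one`, Darmon 2004, Thm. 3.22: `ord_{s=1} L(E,s) ≤ 1 ⇒
rank E(ℚ) = ord ∧ Ш(E/ℚ)` finite), the crux `ShaCotorsionReducible` is EQUIVALENT to its restriction to
the sub-sector `ord_{s=1} L(E,s) ≥ 2 ∧ corank_{ℤ_p} Sel_{p^∞}(E/ℚ) ≥ 1`, stated in corank form
(`corank Sel_{p^∞} ≤ rank`, Greenberg's identity): the regime `r_an ≤ 1` is c2's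
`shaCorank_eq_zero_of_analyticRank_le_one`, the regime corank `0` is
`shaCorank_eq_zero_of_selmerCorank_eq_zero`. What is left is exactly the part of BSD on the Eisenstein
sector for which no engine is in print. [cite: Darmon2004, Thm. 3.22] [cite: Greenberg1999LNM, §1 pp. 54–57] -/
theorem shaCotorsionReducible_iff_residue : Literature.NumberTheory.EllipticCurves.rank_eq_analyticRank_of_analyticRank_le_one → (Summit.BirchSwinnertonDyer.BirchSwinnertonDyer.Theses.ShadowIsolation.ShaCotorsionReducible ↔ ∀ (W : WeierstrassCurve ℚ) [W.IsElliptic] [W.IsGloballyMinimal] (p : ℕ) [Fact p.Prime], 5 ≤ p → W.HasGoodReductionAtPrime p → ¬ (p : ℤ) ∣ W.frobeniusTrace p → ¬ W.HasIrreducibleModPGaloisRep p → 2 ≤ W.analyticRank → 1 ≤ W.selmerCorank p → W.selmerCorank p ≤ W.mordellWeilRank) := by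
  intro hGZK
  constructor
  · intro h W _ _ p _ h5 hgood hord hred _ _
    exact (shaCorank_eq_zero_iff_selmerCorank_le_mordellWeilRank W p).1 (h W p h5 hgood hord hred)
  · intro h W _ _ p _ h5 hgood hord hred
    by_cases hra : W.analyticRank ≤ 1
    · exact shaCorank_eq_zero_of_analyticRank_le_one hGZK W p hra
    by_cases hsc : W.selmerCorank p = 0
    · exact shaCorank_eq_zero_of_selmerCorank_eq_zero W p hsc
    exact (shaCorank_eq_zero_iff_selmerCorank_le_mordellWeilRank W p).2
      (h W p h5 hgood hord hred (by omega) (by omega))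

end Summit.BirchSwinnertonDyer.BirchSwinnertonDyer.Theorems
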